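import Summits.ValiantsHypothesis.ValiantsHypothesis.Theorems.VPBoundarySquareBoundaryDichotomy
import Summits.ValiantsHypothesis.ValiantsHypothesis.Theses.WsBorderSandwich
import Literature.Computability.AlgebraicComplexity.BLMW11VPwsBarSubsetVPBar
import Literature.Computability.AlgebraicComplexity.BLMW11ApproximationProjections
import Literature.Computability.AlgebraicComplexity.ApproxComplexityProjections
import Literature.Computability.AlgebraicComplexity.HomogeneousComponentsComplexity
import Literature.Computability.AlgebraicComplexity.BurgisserBooleanPartsA3Steps
import HarnessLib

/-!
# VP-boundary square × border sandwich — `VP ⊆ closure(VP_ws)` transports to the border: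
`closure(VP) ∩ p-fam ⊆ closure(VP_ws)`, so the sandwich proves BORDER Valiant

Cross-lens kernel (decomp-valiant cycle 1, lens 3 «debordering axis» reading lens 1's route
`WsBorderSandwich`).  Lens 1's piece `B := VPSubsetVPwsBar` (`VP ⊆ closure(VP_ws)`) speaks about
honest `VP` families only, but Zariski closure is idempotent, so `B` propagates to every p-family of
p-bounded BORDER complexity:

* `vpSubsetVPwsBar_iff_uniformWsBordering` — `B` in finite-level form (diagonal over the countably
  many exponents, as the sibling `VPBoundarySquareUniformDebordering.boundaryEmpty_iff_uniformDebordering`): `B ↔ ∀ d, UniformWsBordering d`, one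
  exponent `e` bounding `\underline{L_ws}(g) ≤ n^e + e` for EVERY polynomial `g` of budget `d` at all
  large levels `n` (`u`, `deg g`, `L(g) ≤ n^d + d`).
* `coeffVec_mem_zariskiClosure_degBounded` — approximants may be taken of bounded degree: if
  `deg f ≤ D` and `\underline{L}(f) ≤ r` then `f` lies in the closure of
  `{h | deg h ≤ D, L(h) ≤ (D+2)² r + (D+1)}` (truncation to degree `≤ D` is a linear map of
  coefficient space fixing `f`, continuous for the Zariski topology on the finite-dimensional piece
  `{deg ≤ 2^r}` — `coeffVec_linearMap_mem_zariskiClosure` — and costs `(D+2)²` on each approximant,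
  BCS Lemma 21.25 = `complexity_sum_homogeneousComponent_le`).
* ★ `vpBar_subset_vpwsBar` — **`B ⟹ closure(VP) ∩ p-fam ⊆ closure(VP_ws)`**: the degree-bounded
  approximants of `f_n` are `VP` points of one budget, `UniformWsBordering` puts them in the CLOSED set
  `{\underline{L_ws} ≤ n^e + e}`, hence so is their limit `f_n`.
* ★ `not_vnpSubsetVPBar_of_sandwich` — **`A ∧ B ⟹ VNP ⊄ closure(VP)`** (`A := PerNotInVPwsBar`):
  lens 1's sandwich proves the BORDER form of Valiant's hypothesis, i.e. it closes the summit through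
  the `σ = ¬(VNP ⊆ closure VP)` road of this route's square only (`valiant_of_sandwich` =
  `valiant_of_not_vnpSubsetVPBar ∘ …`, not using `WsBorderSandwich.Assembly`), and it implies this
  route's residual outright: `emptyBoundarySeparates_of_sandwich : A → B → Q`.
* `perNotInVPwsBar_iff_not_vnpSubsetVPBar` — given `B`, lens 1's residual `A` IS border Valiant
  (`A ↔ VNP ⊄ closure(VP)`; the direction `←` is unconditional, BLMW Prop. 9.3.2 + `closure(VP_ws) ⊆
  closure(VP)`).
* `vpwsBoundaryPoint_of_vpBoundaryPoint` — given `B`, a boundary point of `VP` ([GCT5] question,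
  item `BoundaryOfVPNonempty`) is a boundary point of `VP_ws`.

Nothing here proves `VP ≠ VNP`, `A`, `B` or `Q`; LADDER-Valiant rung 0.

References: Bürgisser–Landsberg–Manivel–Weyman 2011, Def. 9.3.1, §9.3, Prop. 9.3.2
(`BurgisserEtAl2011`); Bürgisser–Clausen–Shokrollahi 1997, Lemma 21.25; Bürgisser 2000, Def. 2.1–2.4;
Bürgisser 2004, §4 (closure under projections / degree of approximations).
-/

noncomputable section

set_option linter.dupNamespace false

open MvPolynomial
open Literature.Computability.AlgebraicComplexity Literature.Computability.Complexity
open Summit.ValiantsHypothesis.ValiantsHypothesis.Theses.VPBoundarySquare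
open Summit.ValiantsHypothesis.ValiantsHypothesis.Theorems.VPBoundarySquareBoundaryDichotomy
open Summit.ValiantsHypothesis.ValiantsHypothesis.Theses.WsBorderSandwich (VPSubsetVPwsBar PerNotInVPwsBar)

namespace Summit.ValiantsHypothesis.ValiantsHypothesis.Theorems.VPBoundarySquareWsSandwich

/-! ### Small generic facts -/

/-- An eventually polynomial bound is a p-bound (the finitely many early levels contribute a
constant). [cite: Burgisser2000, Def. 2.1(1)] -/
theorem isPBounded_of_eventually {t : ℕ → ℕ} {e N : ℕ} (h : ∀ n, N ≤ n → t n ≤ n ^ e + e) :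
    IsPBounded t := by
  classical
  let M : ℕ := (Finset.range N).sup t
  have hM : ∀ n, n < N → t n ≤ M := fun n hn => Finset.le_sup (f := t) (Finset.mem_range.2 hn)
  have hpb : IsPBounded fun n => M + (n ^ e + e) :=
    IsPBounded.add_holds (IsPBounded.const M) ⟨e, fun n => le_rfl⟩
  refine hpb.mono fun n => ?_
  by_cases hn : N ≤ n
  · exact (h n hn).trans (Nat.le_add_left _ _)
  · exact (hM n (not_le.1 hn)).trans (Nat.le_add_right _ _)

/-- Selection of pairwise distinct escape levels (diagonal over the countably many exponents): if
for every index `t` escapes occur beyond every bound, pick them at strictly increasing levels.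
[cite: Burgisser2000, Def. 2.1(1)] -/
theorem exists_injective_selection_nat {Esc : ℕ → ℕ → Prop} (h : ∀ t N, ∃ n, N ≤ n ∧ Esc t n) :
    ∃ lev : ℕ → ℕ, Function.Injective lev ∧ ∀ t, Esc t (lev t) := by
  classical
  choose esc hge hesc using h
  let lev : ℕ → ℕ := fun t => Nat.rec (esc 0 0) (fun t b => esc (t + 1) (b + 1)) t
  have hlev_zero : lev 0 = esc 0 0 := rfl
  have hlev_succ : ∀ t, lev (t + 1) = esc (t + 1) (lev t + 1) := fun t => rfl
  have hmono : StrictMono lev := strictMono_nat_of_lt_succ fun t => by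
    rw [hlev_succ]
    exact Nat.lt_of_lt_of_le (Nat.lt_succ_self _) (hge _ _)
  refine ⟨lev, hmono.injective, fun t => ?_⟩
  cases t with
  | zero => rw [hlev_zero]; exact hesc 0 0
  | succ t => rw [hlev_succ]; exact hesc _ _

/-- `deg g ≤ 2 ^ L(g)` (Bürgisser's degree bound at a size-optimal fan-in-two circuit).
[cite: Burgisser2000TCS, Lemma 2.4 p. 77] -/
theorem totalDegree_le_two_pow_complexity {σ : Type*} (g : MvPolynomial σ ℂ) :
    g.totalDegree ≤ 2 ^ complexity g := by
  obtain ⟨P, h2, hP, hsize⟩ := ArithCircuit.exists_computes_size_eq_complexity g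
  rw [← hsize, ← show P.eval = g from hP]
  exact totalDegree_eval_le_two_pow_size h2

/-! ### `B` in finite-level form: uniform border weakly-skew simulation -/

/-- **`VP` point of budget `d` at level `n`**: at most `n^d + d` variables, degree and circuit
complexity at most `n^d + d`. [cite: Burgisser2000, Def. 2.3–2.4] -/
def IsVPPoint (d n : ℕ) {u : ℕ} (g : MvPolynomial (Fin u) ℂ) : Prop :=
  u ≤ n ^ d + d ∧ g.totalDegree ≤ n ^ d + d ∧ complexity g ≤ n ^ d + d

/-- **Uniform border-ws simulation at budget `d`**: ONE exponent `e` bounds the approximate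
weakly-skew complexity `\underline{L_ws}` of EVERY `VP` point of budget `d`, at all large levels.
[cite: BurgisserEtAl2011, Def. 9.3.1] -/
def UniformWsBordering (d : ℕ) : Prop :=
  ∃ e N : ℕ, ∀ n, N ≤ n → ∀ (u : ℕ) (g : MvPolynomial (Fin u) ℂ),
    IsVPPoint d n g → approxWsComplexity g ≤ n ^ e + e

/-- Escape form of `¬ UniformWsBordering d`. [cite: BurgisserEtAl2011, Def. 9.3.1] -/
theorem not_uniformWsBordering_iff (d : ℕ) :
    ¬ UniformWsBordering d ↔ ∀ e N : ℕ, ∃ n, N ≤ n ∧ ∃ (u : ℕ) (g : MvPolynomial (Fin u) ℂ),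
      IsVPPoint d n g ∧ n ^ e + e < approxWsComplexity g := by
  simp [UniformWsBordering]

/-- The zero polynomial in no variables is a `VP` point of every budget (`L(0) = L(C 0) = 0`).
[cite: Burgisser2000, Def. 2.1] -/
theorem isVPPoint_zero (d n : ℕ) : IsVPPoint d n (0 : MvPolynomial (Fin 0) ℂ) := by
  refine ⟨Nat.zero_le _, by simp, ?_⟩
  have h0 : complexity (0 : MvPolynomial (Fin 0) ℂ) = 0 := by
    have := complexity_C_holds (k := ℂ) (σ := Fin 0) 0
    rwa [C_0] at this
  exact h0.le.trans (Nat.zero_le _)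

/-- **(⇒) families ⟹ finite levels**, by diagonalisation over the countably many exponents: if budget
`d` is not uniformly ws-bordered, select pairwise distinct escape levels `n_e` carrying `VP` points
`g_e` of budget `d` with `\underline{L_ws}(g_e) > n_e^e + e`; padded by `0` they form ONE `VP` family,
which `B` puts in `closure(VP_ws)` with some exponent `e₀` — contradiction at `n_{e₀}`.
[cite: BurgisserEtAl2011, §9.3 (Def. 9.3.1)] [cite: Burgisser2000, Def. 2.1(1)] -/
theorem uniformWsBordering_of_vpSubsetVPwsBar (hB : VPSubsetVPwsBar) (d : ℕ) :
    UniformWsBordering d := by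
  classical
  by_contra hneg
  have hEsc : ∀ (e N : ℕ), ∃ n, N ≤ n ∧ ∃ (u : ℕ) (g : MvPolynomial (Fin u) ℂ),
      IsVPPoint d n g ∧ n ^ e + e < approxWsComplexity g := (not_uniformWsBordering_iff d).1 hneg
  obtain ⟨lev, hinj, hlev⟩ := exists_injective_selection_nat hEsc
  choose u g hvp hlt using hlev
  -- the diagonal family
  obtain ⟨pick, hpick_vp, hpick_eq⟩ : ∃ pick : ℕ → Σ u : ℕ, MvPolynomial (Fin u) ℂ,
      (∀ n, IsVPPoint d n (pick n).2) ∧ ∀ e, pick (lev e) = ⟨u e, g e⟩ := by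
    refine ⟨fun n => if h : ∃ e, lev e = n then ⟨u h.choose, g h.choose⟩ else ⟨0, 0⟩, ?_, ?_⟩
    · intro n
      by_cases h : ∃ e, lev e = n
      · have key := hvp h.choose
        rw [h.choose_spec] at key
        beta_reduce
        rw [dif_pos h]
        exact key
      · beta_reduce
        rw [dif_neg h]
        exact isVPPoint_zero d n
    · intro e
      have h : ∃ e', lev e' = lev e := ⟨e, rfl⟩
      have he : h.choose = e := hinj h.choose_spec
      simp only [dif_pos h]
      rw [he]
  have hVP : IsVPFamily (fun n => (pick n).2) :=
    ⟨⟨⟨d, fun n => by simpa [Fintype.card_fin] using (hpick_vp n).1⟩,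
      ⟨d, fun n => (hpick_vp n).2.1⟩⟩, ⟨d, fun n => (hpick_vp n).2.2⟩⟩
  -- `B` puts the diagonal family in `closure(VP_ws)` with ONE exponent `e₀` …
  obtain ⟨e₀, he₀⟩ := hB (fun n => (pick n).2) hVP
  -- … contradicted at the escape level chosen for `e₀`
  have key := he₀ (lev e₀)
  have hlt₀ := hlt e₀
  simp only at key
  rw [hpick_eq e₀] at key
  exact absurd key (not_le.2 hlt₀)

/-- **(⇐) finite levels ⟹ families**: uniform ws-bordering at every budget gives `VP ⊆ closure(VP_ws)`
(rename the variables to `Fin (card σ n)`, `\underline{L_ws}` being invariant under bijective renaming;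
levels below the threshold contribute a constant). [cite: BurgisserEtAl2011, §9.3 (closed under p-projections)] [cite: Burgisser2000, Def. 2.1(1)] -/
theorem vpSubsetVPwsBar_of_uniformWsBordering (h : ∀ d, UniformWsBordering d) : VPSubsetVPwsBar := by
  classical
  intro σ _ _ f hf
  obtain ⟨d, hd⟩ := IsPBounded.add_holds (IsPBounded.add_holds hf.1.1 hf.1.2) hf.2
  have hvp : ∀ n, IsVPPoint d n (rename (Fintype.equivFin (σ n)) (f n)) := by
    intro n
    have hdn := hd n
    dsimp only at hdn
    refine ⟨by omega, ?_, ?_⟩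
    · exact (totalDegree_rename_le _ _).trans (by omega)
    · exact (complexity_rename_le_holds' (Fintype.equivFin (σ n)) (f n)).trans (by omega)
  obtain ⟨e, N, hN⟩ := h d
  show IsPBounded fun n => approxWsComplexity (f n)
  refine isPBounded_of_eventually (e := e) (N := N) fun n hn => ?_
  have key := hN n hn _ _ (hvp n)
  rwa [approxWsComplexity_rename_equiv] at key

/-- ★ **`B` ⟺ uniform border-ws simulation at every budget.** [cite: BurgisserEtAl2011, §9.3 (Def. 9.3.1)] -/
theorem vpSubsetVPwsBar_iff_uniformWsBordering : VPSubsetVPwsBar ↔ ∀ d, UniformWsBordering d :=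
  ⟨uniformWsBordering_of_vpSubsetVPwsBar, vpSubsetVPwsBar_of_uniformWsBordering⟩

/-! ### Degree-bounded approximants -/

section Truncation

variable {σ : Type*}

/-- Truncation to degree `≤ D` (the sum of the homogeneous components of degree `≤ D`) as a linear map
of coefficient space. [cite: BurgisserClausenShokrollahi1997, Lemma (21.25)] -/
def truncDeg (σ : Type*) (D : ℕ) : MvPolynomial σ ℂ →ₗ[ℂ] MvPolynomial σ ℂ :=
  ∑ e ∈ Finset.range (D + 1), homogeneousComponent e

/-- The truncation is the sum of the homogeneous components of degree `≤ D`.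
[cite: BurgisserClausenShokrollahi1997, Lemma (21.25)] -/
theorem truncDeg_apply (D : ℕ) (f : MvPolynomial σ ℂ) :
    truncDeg σ D f = ∑ e ∈ Finset.range (D + 1), homogeneousComponent e f := by
  simp only [truncDeg, LinearMap.coe_sum, Finset.sum_apply]

/-- Truncation at `D ≥ deg f` fixes `f`. [cite: BurgisserClausenShokrollahi1997, Lemma (21.25)] -/
theorem truncDeg_eq_self {D : ℕ} {f : MvPolynomial σ ℂ} (h : f.totalDegree ≤ D) :
    truncDeg σ D f = f := by
  rw [truncDeg_apply]
  have hsub : Finset.range (f.totalDegree + 1) ⊆ Finset.range (D + 1) :=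
    Finset.range_mono (Nat.succ_le_succ h)
  rw [← Finset.sum_subset hsub (fun e _ hne => homogeneousComponent_eq_zero _ _
    (by rw [Finset.mem_range] at hne; omega))]
  exact sum_homogeneousComponent f

/-- A truncation has degree `≤ D`. [cite: BurgisserClausenShokrollahi1997, Lemma (21.25)] -/
theorem totalDegree_truncDeg_le (D : ℕ) (f : MvPolynomial σ ℂ) :
    (truncDeg σ D f).totalDegree ≤ D := by
  rw [truncDeg_apply]
  refine (totalDegree_finsetSum _ _).trans (Finset.sup_le fun e he => ?_)
  rw [Finset.mem_range] at he
  exact (homogeneousComponent_isHomogeneous e f).totalDegree_le.trans (by omega)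

/-- Truncation costs `(D+2)²` (BCS Lemma 21.25, all components at once).
[cite: BurgisserClausenShokrollahi1997, Lemma (21.25)] -/
theorem complexity_truncDeg_le (D : ℕ) (f : MvPolynomial σ ℂ) :
    complexity (truncDeg σ D f) ≤ (D + 2) ^ 2 * complexity f + (D + 1) := by
  rw [truncDeg_apply]
  exact complexity_sum_homogeneousComponent_le f D

/-- ★ **Degree-bounded approximants.** If `deg f ≤ D` and `\underline{L}(f) ≤ r` then `coeff f` lies in
the Zariski closure of the polynomials of degree `≤ D` AND complexity `≤ (D+2)² r + (D+1)`: the size-`r`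
approximants are supported in the finite box `{deg ≤ 2^r}`, truncation to degree `≤ D` is a linear map
there, continuous for the Zariski topology (`coeffVec_linearMap_mem_zariskiClosure`), fixes `f`, and
maps each approximant to a polynomial of the stated degree and size.
[cite: BurgisserEtAl2011, §9.3 (Def. 9.3.1)] [cite: BurgisserClausenShokrollahi1997, Lemma (21.25)] [cite: Burgisser2004Factors, §4] -/
theorem coeffVec_mem_zariskiClosure_degBounded [Fintype σ] [DecidableEq σ] {f : MvPolynomial σ ℂ}
    {D r : ℕ} (hD : f.totalDegree ≤ D) (hr : approxComplexity f ≤ r) :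
    coeffVec f ∈ zariskiClosure (coeffVec '' {h : MvPolynomial σ ℂ |
      h.totalDegree ≤ D ∧ complexity h ≤ (D + 2) ^ 2 * r + (D + 1)}) := by
  have hf : coeffVec f ∈ zariskiClosure
      (coeffVec '' {g : MvPolynomial σ ℂ | complexity g ≤ r}) := by
    refine zariskiClosure_mono ?_ (coeffVec_mem_zariskiClosure_approxComplexity f)
    rintro _ ⟨g, hg, rfl⟩
    exact ⟨g, (show complexity g ≤ approxComplexity f from hg).trans hr, rfl⟩
  have hsupp : ∀ g ∈ {g : MvPolynomial σ ℂ | complexity g ≤ r},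
      g.support ⊆ (Finset.range (2 ^ r + 1)).biUnion
        (fun n => (Finset.univ : Finset σ).finsuppAntidiag n) := fun g hg =>
    support_subset_degBox_of_totalDegree_le
      ((totalDegree_le_two_pow_complexity g).trans (Nat.pow_le_pow_right two_pos hg))
  have hT := coeffVec_linearMap_mem_zariskiClosure (truncDeg σ D) hsupp hf
  rw [truncDeg_eq_self hD] at hT
  refine zariskiClosure_mono ?_ hT
  rintro _ ⟨_, ⟨g, hg, rfl⟩, rfl⟩
  refine ⟨truncDeg σ D g, ⟨totalDegree_truncDeg_le D g, ?_⟩, rfl⟩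
  have hg' : complexity g ≤ r := hg
  exact (complexity_truncDeg_le D g).trans (Nat.add_le_add_right (Nat.mul_le_mul_left _ hg') _)

end Truncation

/-! ### `closure(VP) ∩ p-fam ⊆ closure(VP_ws)` under uniform ws-bordering -/

/-- ★ **Uniform ws-bordering transports to the border**: if every budget is uniformly ws-bordered, a
p-family of p-bounded border complexity `\underline{L}` has p-bounded border weakly-skew complexity
`\underline{L_ws}` — the degree-bounded approximants of `f_n` (`coeffVec_mem_zariskiClosure_degBounded`)
are `VP` points of ONE budget `d`, so they lie in the Zariski-CLOSED set `{\underline{L_ws} ≤ n^e + e}`,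
hence so does `f_n`. [cite: BurgisserEtAl2011, §9.3 (Def. 9.3.1)] [cite: Burgisser2000, Def. 2.3] -/
theorem isVPwsBarFamily_of_isVPBarFamily (hU : ∀ d, UniformWsBordering d) {v : ℕ → ℕ}
    (f : ∀ n, MvPolynomial (Fin (v n)) ℂ) (hPF : IsPFamily f) (hBar : IsVPBarFamily f) :
    IsVPwsBarFamily f := by
  classical
  obtain ⟨c, hc⟩ := IsPBounded.add_holds (IsPBounded.add_holds hPF.1 hPF.2) hBar
  -- the budget of the truncated approximants is polynomial
  have hpoly : IsPBounded fun n =>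
      (n ^ c + c) + ((n ^ c + c + 2) ^ 2 * (n ^ c + c) + (n ^ c + c + 1)) := by
    have hb : IsPBounded fun n => n ^ c + c := ⟨c, fun n => le_rfl⟩
    exact IsPBounded.add_holds hb (IsPBounded.add_holds (IsPBounded.mul_holds
      (IsPBounded.pow_holds (IsPBounded.add_holds hb (IsPBounded.const 2)) 2) hb)
      (IsPBounded.add_holds hb (IsPBounded.const 1)))
  obtain ⟨d, hd⟩ := hpoly
  obtain ⟨e, N, hN⟩ := hU d
  show IsPBounded fun n => approxWsComplexity (f n)
  refine isPBounded_of_eventually (e := e) (N := N) fun n hn => ?_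
  have hcn := hc n
  have hdn := hd n
  simp only [Fintype.card_fin] at hcn
  dsimp only at hdn
  have hmem := coeffVec_mem_zariskiClosure_degBounded (f := f n) (D := n ^ c + c) (r := n ^ c + c)
    (by omega) (by omega)
  refine approxWsComplexity_le_of_mem (zariskiClosure_image_subset_of_subset ?_ hmem)
  rintro _ ⟨h, ⟨hdeg, hcx⟩, rfl⟩
  have hvp : IsVPPoint d n h := ⟨by omega, by omega, by omega⟩
  refine zariskiClosure_mono ?_ (coeffVec_mem_zariskiClosure_approxWsComplexity h)
  rintro _ ⟨g, hg, rfl⟩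
  exact ⟨g, (show wsComplexity g ≤ approxWsComplexity h from hg).trans (hN n hn _ h hvp), rfl⟩

/-! ### Consequences for the two routes -/

/-- ★ **`B ⟹ closure(VP) ∩ p-fam ⊆ closure(VP_ws)`**: lens 1's `VPSubsetVPwsBar`, stated for honest
`VP` families, propagates to every p-family of p-bounded border complexity (closure is idempotent).
[cite: BurgisserEtAl2011, §9.3] -/
theorem vpBar_subset_vpwsBar (hB : VPSubsetVPwsBar) {v : ℕ → ℕ}
    (f : ∀ n, MvPolynomial (Fin (v n)) ℂ) (hPF : IsPFamily f) (hBar : IsVPBarFamily f) :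
    IsVPwsBarFamily f :=
  isVPwsBarFamily_of_isVPBarFamily (uniformWsBordering_of_vpSubsetVPwsBar hB) f hPF hBar

/-- ★ **The border sandwich proves BORDER Valiant: `A ∧ B ⟹ VNP ⊄ closure(VP)`.** If `VNP ⊆ closure(VP)`
then the permanent family (renamed to `Fin (n·n)`, a `VNP` family by Valiant 1979) is in `closure(VP)`,
hence by `B` in `closure(VP_ws)`, contradicting `A = PerNotInVPwsBar`.
[cite: BurgisserEtAl2011, Prop. 9.3.2] [cite: Valiant1979] -/
theorem not_vnpSubsetVPBar_of_sandwich (hA : PerNotInVPwsBar) (hB : VPSubsetVPwsBar) :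
    ¬ VNPSubsetVPBar := by
  intro H
  have hvnp : IsVNPFamily (fun n => rename (finProdFinEquiv (m := n) (n := n))
      (perPoly (Fin n) ℂ)) := by
    have h := (isVNPFamily_renameEquiv_iff (σ := fun n => Fin n × Fin n)
      (fun n => finProdFinEquiv (m := n) (n := n)) (fun n => perPoly (Fin n) ℂ)).2
      (isVNPFamily_perPoly_holds ℂ)
    simpa only [renameEquiv_apply] using h
  have hbar := H (fun n => n * n) _ hvnp
  have hws := vpBar_subset_vpwsBar hB _ hvnp.1 hbar
  exact hA ((isVPwsBarFamily_rename_equiv_iff (fun n => finProdFinEquiv (m := n) (n := n))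
    (fun n => perPoly (Fin n) ℂ)).1 hws)

/-- Hence the sandwich closes the summit THROUGH the border form (`σ = ¬(VNP ⊆ closure VP)` road of the
VP-boundary square), without the item `WsBorderSandwich.Assembly`. [cite: BurgisserEtAl2011, Prop. 9.3.2] -/
theorem valiant_of_sandwich (hA : PerNotInVPwsBar) (hB : VPSubsetVPwsBar) : _root_.ValiantsHypothesis :=
  valiant_of_not_vnpSubsetVPBar (not_vnpSubsetVPBar_of_sandwich hA hB)

/-- … and it implies this route's residual `Q := EmptyBoundarySeparates` outright (its conclusion holds).
[cite: BurgisserEtAl2011, Prop. 9.3.2] -/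
theorem emptyBoundarySeparates_of_sandwich (hA : PerNotInVPwsBar) (hB : VPSubsetVPwsBar) :
    EmptyBoundarySeparates := by
  intro _
  exact not_vnpSubsetVPBar_of_sandwich hA hB

/-- **Border Valiant ⟹ `A`** (unconditional): if `(per) ∈ closure(VP_ws)` then `VNP ⊆ closure(VP_ws) ⊆
closure(VP)` (VNP-completeness of the permanent, BLMW Prop. 9.3.2; `closure(VP_ws) ⊆ closure(VP)`).
[cite: BurgisserEtAl2011, Prop. 9.3.2] [cite: BurgisserEtAl2011, §9.3 (VP_ws-bar ⊆ VP-bar)] -/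
theorem perNotInVPwsBar_of_not_vnpSubsetVPBar (h : ¬ VNPSubsetVPBar) : PerNotInVPwsBar := by
  intro hper
  exact h fun v f hf => (vnp_subset_vpwsBar_of_isVPwsBarFamily_perPoly hper v f hf).isVPBarFamily

/-- ★ **Given `B`, lens 1's residual `A` IS border Valiant**: `A ↔ VNP ⊄ closure(VP)`.
[cite: BurgisserEtAl2011, Prop. 9.3.2] -/
theorem perNotInVPwsBar_iff_not_vnpSubsetVPBar (hB : VPSubsetVPwsBar) :
    PerNotInVPwsBar ↔ ¬ VNPSubsetVPBar :=
  ⟨fun hA => not_vnpSubsetVPBar_of_sandwich hA hB, perNotInVPwsBar_of_not_vnpSubsetVPBar⟩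

/-- **Given `B`, a boundary point of `VP` is a boundary point of `VP_ws`**: a p-family in
`closure(VP) ∖ VP` (the [GCT5] question, item `BoundaryOfVPNonempty`) lies in `closure(VP_ws)` by
`vpBar_subset_vpwsBar` and outside `VP_ws ⊆ VP`. [cite: BurgisserEtAl2011, §9.1 (VP_ws)] [cite: GrochowMulmuleyQiao2016, §1] -/
theorem vpwsBoundaryPoint_of_vpBoundaryPoint (hB : VPSubsetVPwsBar) (hM : BoundaryOfVPNonempty) :
    ∃ (v : ℕ → ℕ) (f : ∀ n, MvPolynomial (Fin (v n)) ℂ),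
      IsPFamily f ∧ IsVPwsBarFamily f ∧ ¬ IsVPwsFamily f := by
  classical
  by_contra hcon
  apply hM
  intro v f hPF hBar
  by_contra hnot
  exact hcon ⟨v, f, hPF, vpBar_subset_vpwsBar hB f hPF hBar, fun hws => hnot hws.isPBounded_complexity⟩

end Summit.ValiantsHypothesis.ValiantsHypothesis.Theorems.VPBoundarySquareWsSandwich

end
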